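import Summits.BirchSwinnertonDyer.BirchSwinnertonDyer.Theorems.ByReductionTypeAtTwoSupersingularHondaSystemAtTwoLogs
import Summits.BirchSwinnertonDyer.BirchSwinnertonDyer.Theorems.ByReductionTypeAtTwoSupersingularHondaSystemAtTwoExists
import HarnessLib

/-!
# Sprung's Honda system AT `p = 2`, X: THE Honda system of (C1) over `ℚ_v` WITH ITS `ℚ_[2]`-MODEL AND LOGARITHMS (FILE E0b of the ♭
# explicit reciprocity computation at `2` — crux `SupersingularRankZeroAtTwo`, item stmt-BirchSwinnertonDyer-19097, line `odd_blind_package`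
# v2.19, `stub_flatPackage` conjunct (8), F3)

Seat `bsd-2adic-tower-1` GEN 69, hand «hF3-ERL». Sequel of IX (`…Logs`: `sprungPrimal_padic_withLog`) and VIII (`…Exists`: the transport
`ℚ_[2] → ℚ_v` and `isHondaSystemAtTwo_of_primal`). HONEST FRAMING: theorems only (no definition, no named fact, no instance, no `sorry`);
a LOCAL construction at `2`; helper toward conjunct (8) F3 of `stub_flatPackage`; closes no stub and no item; 19097 OPEN; BSD₂ is proved for no
supersingular curve and BSD for no curve by any of this.

## What

(8) quantifies over Honda systems `IsHondaSystemAtTwo κ (closureEmb ℚ_v) W a₂ g cneg c` over the completion `ℚ_v` (`v ∣ 2`), while the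
logarithms of FILEs E0/E1 live on the `ℚ_[2]`-model. ★ `isHondaSystemAtTwo_sprung_withLog` packages, for every `g` over the topological
generator, THE Honda system of VIII (`SSHondaTwo.hondaSystemAtTwoExists`) TOGETHER WITH: the model isomorphism `Φ : ℚ̄₂ ≃ \overline{ℚ_v}`
(`φ` on `ℚ_[2]`, `closureEmb = Φ ∘ ι`), Sprung's sequence `x`, the tower points `y_m` with their display clauses (`Λ(T⁻¹ y_m) = ℓ_m(x)`),
stabilisers, inverters `σ_m`, `N = 3 − a₂`, the `ℚ_[2]`-points `d₀ n = N•(y_{n+2} + σ•y_{n+2}) − 2•y_1` with their levels, and the TRANSPORT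
equations `cneg = Φ(−y_1)`, `c n = Φ(d₀ n)` — K3's `PlusLayer.plusHondaSystemTwo_adicCompletion_withLog` shape — so that E1's log character sums
(stated for `d₀` on the model) apply to the system (8) sees, by `hTg`-type transport of the `g`-orbits (K3 `LocalVar.exists_localVariable_two`).

References: [Sprung2012] F. Sprung, J. Number Theory 132 (2012), Thm. 2.2 (pp. 1486–1487), Lemma 2.3; [Kobayashi2003] §8 (Lemma 8.9, Props.
8.11–8.12); [MilneADT2006] I Lemma 3.3; [SerreGaloisCohomology1997] II.§1.1.
-/

set_option autoImplicit false
-- the Theorems namespace of this sub repeats the summit name by design (D-0017 nested layout)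
set_option linter.dupNamespace false

noncomputable section

open scoped Classical NumberField

namespace Summit.BirchSwinnertonDyer.BirchSwinnertonDyer.Theorems.SSHondaTwo

open Field WeierstrassCurve NumberField IsDedekindDomain Literature.NumberTheory.EllipticCurves
  Literature.NumberTheory.GaloisRepresentations Literature.RingTheory.FormalGroups
  Literature.NumberTheory.EllipticCurves.ZpExtension Literature.NumberTheory.EllipticCurves.Kobayashi2003
  Literature.NumberTheory.EllipticCurves.FormalGroupChart Literature.NumberTheory.EllipticCurves.Rank1Residual
  Summit.BirchSwinnertonDyer.Rank1Residual.Additive Summit.BirchSwinnertonDyer.Rank1Residual.Additive.PadicCyclotomicTower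
  Summit.BirchSwinnertonDyer.Rank1Residual.Additive.BallEval Summit.BirchSwinnertonDyer.Rank1Residual.Additive.HondaFss
  Summit.BirchSwinnertonDyer.Rank1Residual.Additive.LocalTransport
  Summit.BirchSwinnertonDyer.BirchSwinnertonDyer.Theorems.SignedKatoOffTwo.LocalAllPrimes
  Summit.BirchSwinnertonDyer.BirchSwinnertonDyer.Theorems.SignedKatoOffTwo.LocalTwo
  Summit.BirchSwinnertonDyer.BirchSwinnertonDyer.Theorems.SignedEC
  Summit.BirchSwinnertonDyer.BirchSwinnertonDyer.Theorems.SignedEC.PlusLayer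
  Summit.BirchSwinnertonDyer.BirchSwinnertonDyer.Theorems.SignedEC.PlusTower
  Summit.BirchSwinnertonDyer.Rank1Residual.F1Sign2

/-- **THE Honda system of (C1) over `ℚ_v`, with its `ℚ_[2]`-model, Sprung sequence, tower points, logarithms and transport equations.**
For `W/ℚ` globally minimal with `GoodSS W 2` (`a₂ ∈ {0, ±2}`), the cyclotomic `κ`, `v ∣ 2` and a local `g` over the topological generator:
a model isomorphism `(Φ, φ, ι)` with `closureEmb = Φ ∘ ι`, the data of `sprungPrimal_padic_withLog` for `ι`, and `cneg = Φ(−y_1)`, `c n = Φ(d₀ n)`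
with `IsHondaSystemAtTwo κ (closureEmb ℚ_v) W a₂ g cneg c`. [cite: Sprung2012, Thm. 2.2 (pp. 1486–1487), Lemma 2.3]
[cite: Kobayashi2003, Lemma 8.9, Props. 8.11–8.12] [cite: MilneADT2006, I Lemma 3.3] -/
theorem isHondaSystemAtTwo_sprung_withLog (W : WeierstrassCurve ℚ) [W.IsElliptic] [W.IsGloballyMinimal]
    (hss : GoodSS W 2) (κ : ZpExtension ℚ 2) (hκ : κ.IsCyclotomic)
    (v : HeightOneSpectrum (𝓞 ℚ)) (hv : (2 : 𝓞 ℚ) ∈ v.asIdeal)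
    (g : absoluteGaloisGroup (v.adicCompletion ℚ)) (hg : κ.IsTopGenerator (resGalOfEmb (closureEmb (K := ℚ) (v.adicCompletion ℚ)) g)) :
    ∃ (Φ : AlgebraicClosure ℚ_[2] ≃ₐ[ℚ] AlgebraicClosure (v.adicCompletion ℚ)) (φ : ℚ_[2] ≃+* v.adicCompletion ℚ)
      (_ : ∀ t : ℚ_[2], Φ (algebraMap ℚ_[2] (AlgebraicClosure ℚ_[2]) t) =
        algebraMap (v.adicCompletion ℚ) (AlgebraicClosure (v.adicCompletion ℚ)) (φ t))
      (ι : AlgebraicClosure ℚ →ₐ[ℚ] AlgebraicClosure ℚ_[2])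
      (_ : ∀ z, closureEmb (K := ℚ) (v.adicCompletion ℚ) z = Φ (ι z))
      (x : ℕ → ℚ_[2]) (y : ℕ → localPoints W ℚ_[2]) (σ : ℕ → absoluteGaloisGroup ℚ_[2]) (N : ℕ)
      (d₀ : ℕ → localPoints W ℚ_[2]) (cneg : localPoints W (v.adicCompletion ℚ)) (c : ℕ → localPoints W (v.adicCompletion ℚ)),
      (x 0 = 1 ∧ (2 : ℚ_[2]) * x 1 = W.frobeniusTrace 2 ∧ ∀ k, (2 : ℚ_[2]) * x (k + 2) = W.frobeniusTrace 2 * x (k + 1) - x k) ∧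
      (haveI := isIntegral_genFib_baseChange 2 ((integralModelInt W).map (Int.castRingHom ℤ_[2]))
        ∀ m, (toLoc ((genFibΩ_eq_baseChange ((integralModelInt W).map (Int.castRingHom ℤ_[2]))).trans
              (baseChange_twoAdicModel W))).symm (y m) ∈
            subfieldPoints (genFibΩ 2 ((integralModelInt W).map (Int.castRingHom ℤ_[2]))) (layer 2 m).toSubfield
              coeffs_mem_layer ∧
          (toLoc ((genFibΩ_eq_baseChange ((integralModelInt W).map (Int.castRingHom ℤ_[2]))).trans
              (baseChange_twoAdicModel W))).symm (y m) ∈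
            kernel (Valued.v (R := PadicAlgCl 2)) (genFibΩ 2 ((integralModelInt W).map (Int.castRingHom ℤ_[2]))) ∧
          ptLogΩ 2 ((integralModelInt W).map (Int.castRingHom ℤ_[2]))
            ((toLoc ((genFibΩ_eq_baseChange ((integralModelInt W).map (Int.castRingHom ℤ_[2]))).trans
              (baseChange_twoAdicModel W))).symm (y m)) =
            ∑ k ∈ Finset.range m, algebraMap ℚ_[2] (PadicAlgCl 2) (x k) * (zeta 2 (m - k) - 1)) ∧
      (∀ m, ∀ τ ∈ stab 2 m, τ • y m = y m) ∧
      (∀ m, 1 ≤ m → σ m • zeta 2 m = (zeta 2 m)⁻¹) ∧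
      ((N : ℤ) = 3 - W.frobeniusTrace 2 ∧ Odd N) ∧
      (∀ n, d₀ n = N • (y (n + 2) + σ (n + 2) • y (n + 2)) - 2 • y 1) ∧
      (∀ m, d₀ m ∈ localLayerPointsOfEmb κ ι W m) ∧
      cneg = WeierstrassCurve.Affine.Point.map (W' := W)
        (Φ : AlgebraicClosure ℚ_[2] →ₐ[ℚ] AlgebraicClosure (v.adicCompletion ℚ))
        (show (W.baseChange (AlgebraicClosure ℚ_[2])).toAffine.Point from (-y 1)) ∧
      (∀ m, c m = WeierstrassCurve.Affine.Point.map (W' := W)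
        (Φ : AlgebraicClosure ℚ_[2] →ₐ[ℚ] AlgebraicClosure (v.adicCompletion ℚ))
        (show (W.baseChange (AlgebraicClosure ℚ_[2])).toAffine.Point from d₀ m)) ∧
      IsHondaSystemAtTwo κ (closureEmb (K := ℚ) (v.adicCompletion ℚ)) W (W.frobeniusTrace 2) g cneg c := by
  obtain ⟨Φ, φ, hf, ι, hcompat⟩ := exists_model_padic_adicCompletion (p := 2) (v := v) (by exact_mod_cast hv)
  obtain ⟨x, y, σ, N, cneg₀, d₀, hx, hyΩ, hystab, hσ, hN, hcneg₀, hd₀, hcnegL, hL, hR0, hR1, hRn, hGEN, hND⟩ :=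
    sprungPrimal_padic_withLog W hss κ hκ ι
  set ιv := closureEmb (K := ℚ) (v.adicCompletion ℚ) with hιv
  let T : localPoints W ℚ_[2] →+ localPoints W (v.adicCompletion ℚ) :=
    WeierstrassCurve.Affine.Point.map (W' := W) (Φ : AlgebraicClosure ℚ_[2] →ₐ[ℚ] AlgebraicClosure (v.adicCompletion ℚ))
  have hT : ∀ P : localPoints W ℚ_[2], T P =
      WeierstrassCurve.Affine.Point.map (W' := W) (Φ : AlgebraicClosure ℚ_[2] →ₐ[ℚ] AlgebraicClosure (v.adicCompletion ℚ))
        (show (W.baseChange (AlgebraicClosure ℚ_[2])).toAffine.Point from P) := fun _ ↦ rfl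
  have hmem := modelMap_mem_localLayerPointsOfEmb_iff Φ φ hf ι ιv hcompat W T hT κ
  -- the transported primal package
  have hcnegL' : T cneg₀ ∈ localLayerPointsOfEmb κ ιv W 0 := (hmem 0 _).mpr hcnegL
  have hL' : ∀ m, T (d₀ m) ∈ localLayerPointsOfEmb κ ιv W m := fun m ↦ (hmem m _).mpr (hL m)
  have hR0' : T (d₀ 0) = (W.frobeniusTrace 2 ^ 2 - 2 * W.frobeniusTrace 2 - 1) • T cneg₀ := by
    rw [hR0, map_zsmul]
  have hR1' : localTraceOfEmb κ ιv W 0 1 (T (d₀ 1)) = W.frobeniusTrace 2 • T (d₀ 0) + (4 - 2 * W.frobeniusTrace 2) • T cneg₀ := by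
    rw [← modelMap_localTraceOfEmb Φ φ hf ι ιv hcompat W T hT κ 0 1 (hL 1), hR1, map_add, map_zsmul, map_zsmul]
  have hRn' : ∀ n : ℕ, 1 ≤ n →
      localTraceOfEmb κ ιv W n (n + 1) (T (d₀ (n + 1))) = W.frobeniusTrace 2 • T (d₀ n) - T (d₀ (n - 1)) := by
    intro n hn
    rw [← modelMap_localTraceOfEmb Φ φ hf ι ιv hcompat W T hT κ n (n + 1) (hL (n + 1)), hRn n hn, map_sub, map_zsmul]
  have hGEN' : ∀ m : ℕ, 1 ≤ m → ∀ P ∈ localLayerPointsOfEmb κ ιv W m,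
      ∃ B ∈ AddSubgroup.closure (Set.range fun τ : absoluteGaloisGroup (v.adicCompletion ℚ) ↦ τ • T (d₀ m)),
        ∃ P' ∈ localLayerPointsOfEmb κ ιv W (m - 1), ∃ R ∈ localLayerPointsOfEmb κ ιv W m, 1 • P = B + P' + 2 • R := by
    intro m hm P' hP'
    obtain ⟨P, rfl⟩ := modelMap_surjective Φ W T hT P'
    obtain ⟨B, hB, P₁, hP₁, R, hR, hPe⟩ := hGEN m hm P ((hmem m P).mp hP')
    refine ⟨T B, ?_, T P₁, (hmem _ _).mpr hP₁, T R, (hmem _ _).mpr hR, by rw [one_nsmul, hPe, map_add, map_add, map_nsmul]⟩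
    rw [← map_modelMap_closure_orbit Φ φ hf W T hT]
    exact AddSubgroup.mem_map_of_mem T hB
  have hND' : ∀ b ∈ localLayerPointsOfEmb κ ιv W 0, T cneg₀ ≠ 2 • b :=
    nonDiv_modelTransport Φ φ hf ι ιv hcompat W T hT κ 2 hND
  have hGEN0 := plusGenZero_two_of_ne_two_nsmul W hss κ v hv ιv hcnegL' hND'
  have hGEN0' : ∀ P ∈ localLayerPointsOfEmb κ ιv W 0, ∃ u : ℤ, ∃ R ∈ localLayerPointsOfEmb κ ιv W 0, 1 • P = u • T cneg₀ + 2 • R := by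
    intro P hP
    obtain ⟨u, R, hR, h⟩ := hGEN0 P hP
    exact ⟨u, R, hR, by rw [one_nsmul]; exact h⟩
  have hH : IsHondaSystemAtTwo κ ιv W (W.frobeniusTrace 2) g (T cneg₀) (fun m ↦ T (d₀ m)) :=
    isHondaSystemAtTwo_of_primal ιv W κ (isUnit_sq_sub_two_mul_sub_one_of_even hss.2) hg (N := 1) (Nat.coprime_one_left 2)
      hcnegL' hL' hR0' hR1' hRn' hGEN' hGEN0'
  refine ⟨Φ, φ, hf, ι, hcompat, x, y, σ, N, d₀, T cneg₀, fun m ↦ T (d₀ m), hx, hyΩ, hystab, hσ, hN, hd₀, hL, ?_, fun _ ↦ rfl, hH⟩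
  rw [hcneg₀]
  exact hT _

end Summit.BirchSwinnertonDyer.BirchSwinnertonDyer.Theorems.SSHondaTwo

end
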